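import Summits.QuantumFields.YangMills.Theorems.BalabanUVNodesN12AtRecord13OfResiduals
import Literature.MathematicalPhysics.QuantumFieldTheory.Balaban1983to89.B15Prop1AtZSequenceRecord
import Literature.MathematicalPhysics.QuantumFieldTheory.Balaban1983to89.B15Eq177ValueInvarianceCoDiv

/-!
# BalabanUVNodes ∕ N12 — THE s1∕s2 JUNCTION AT PRINT's (1.74) OBJECT `U_{k,Z} = U(𝔹_k(Z), ·)`: N12's ROW AT THE LIVE RE-PIN WITH ITS PROPOSITION-1 DISPLAY DISCHARGED AT PRINT's SU(2) BOX INSTANCES, ONE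
# (2.12) SOLUTION MAP PER INSTANCE, and — at `N = 2` — THE BACKGROUND PINNED TO NODE 00's v1.5 CONSTRUCTOR OF RECORD APPLIED TO `Z`'s OWN MAXIMAL SEQUENCE (2.13) (dag-n12-c's LOCATED-CLASS,
# INBOX l.20969, print- and tree-certified: print's `U_{k,Z}` minimises over the class of `Z`'s own sequence `{Ω_n(Z)} = maxDomT M₁ Z`, whose determining set `𝔹_k(Z) = genSet (maxDomT M₁ Z) k` carries
# the constraints; the earlier record twins — dag-n12-c's `…atCoPRecord…` (p529759 ∕ p534598 ∕ p540333) and THIS SEAT's 12Q′ §2 (p528722) ∕ 12Q″ §2 (p544704) — pinned the RUN's class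
# `regMSCoPOfRecord ν Kt kb Ω_run` against `Z`'s determining set, «a (2.12) problem print never poses»: sound theorems about a non-printed object, SUPERSEDED FOR CONSUMPTION by this file) —
# by dag-n12-c's `B15Prop1AtZSequenceRecord` (2026-08-27: `…_ofRecordFamily_ofNearValue` with `av i`, `reg i`, `M₁ i` PER INSTANCE and the consumer's bond decidability `[hdec] (hcl := Subsingleton.elim _ _)`;
# `…_atZSeqCoPRecord_ofNearValue` at `Node00.bgMSCoPOfRecord F 2 ν Kt (k i) (maxDomT ν.M₁ (Z i))` — NODE 00's support convention — and `…_atZSeqCoPRecordTop_ofNearValue` at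
# `Node00.bgMSCoPOfRecordAt F 2 ν Kt (k i) (Z i) (maxDomT ν.M₁ (Z i))` — print's `Ω₀ = Z`; class gauge-invariance DISCHARGED there by `gaugeAct_mem_regMSCoPOfRecord[At]`), with the slice-gradient letter
# (L3) already RETIRED in favour of (Vn) + `hZ1` as in 12Q″ (Track A, DAG node N12 = [B15, Balaban1989LargeFieldI] CMP **122** (1989) 175–202; cluster K1: K1⁷ `StabilityBAtRecordR13SepCoPH` =
# stmt-QuantumFields-20542 (rev 24∕25; N12's rows are edition-free); seat `pub-ymgap-dag-n12-d` g12 (R134 s2 = by-name knit at the record), 2026-08-27; count-neutral, NOT a discharge)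

HONEST FRAMING.  Count-neutral kernel COMPOSITION BY NAME: this seat's 12E (`b15Leaf_WOfRecord₁₃_liveRepin₁₃_of_massLive_of_hasResiduals`, background-free and 𝐓-weight-free) with its
`hP1 : Prop1Printed (λ.LF P)` display FED, run by run, by dag-n12-c's endpoints above; `areg` (print's `a₁`, p. 194) produced by Proposition 1's proof (`choose`).  WHAT IS PINNED HERE BEYOND
12Q″: §1 the background is a FAMILY `bgOfRecord (av P i) (reg P i)` with layer width `M₁ P i` PER INSTANCE `i : ι P` (so print's term-by-term backgrounds — one per large-field history `s` and
box — are obtained by the closer's choice of `ι P`); §2∕§3 at `N = 2` NO BACKGROUND LETTER REMAINS: the background is the OBJECT `bgMSCoPOfRecord F 2 Θ.ν P.K (k P i) (maxDomT Θ.ν.M₁ (Z P i))`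
(resp. `…At … (Z P i) (maxDomT …)`) determined by `(Θ.ν, P.K, k P i, Z P i)` — the letters `kb P`, `Ω P` of 12Q′∕12Q″ §2 are GONE and the class∕pairing mismatch with them.  WHAT STAYS A LETTER:
regions `Z P i ∕ Λ P i`, levels `k P i`, `M P i`, box data; (J1) `hGj` and (L2) `hlead` + `hsm` ∕ `hγle` ([15] Thm 1 ∕ Prop 9-level inputs of NODE 00, now ABOUT `A ∘ U_{k,Z}` AT THE PRINTED
BACKGROUND); (Vn) `hVn` + `hcJ'` (print p. 193 ll. 17–20 = [15] Thm 1 (7)⇒(8) FOR THE ADMISSIBLE SEQUENCE `maxDomT ν.M₁ Z` — dag-n12-c LOCATED-GENFORM: the general-sequence edition of K0's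
`VariationalThm1RegSepCoP7M`, a NODE 00 [15]-leaf + the (7)-transfer — N07's estimate); the box inclusion `hZ1` (⇒ `hfar` by `far_letter_of_box`); `hk0` ∕ `hk`; N12's per-run displays BELOW THE
TORUS (the (1.100) pin equation, live-mass — NODE 00 —, (1.80), (1.89) — dag-n12-e's pins).  Nothing of Bałaban's is asserted; N12 is NOT discharged; no node is discharged; counts unmoved
(discharged 5∕27 · Track A 5∕28).  TYPING NOTE: dag-n12-c's family endpoints take the CONSUMER's bond decidability `[hdec : ∀ j, DecidableEq (PBond P j)]` pinned propositionally (`hcl`), so here every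
hypothesis body and the pinned `LF` term are written at the AMBIENT instance of the Record-13 cone — NO `letI` wrapper (contrast 12Q′∕12Q″) — and `hcl := Subsingleton.elim _ _`; `blockIter` is
written `B14.Eq22Determines.blockIter`.  The `θ₁₅ᶜ` twin of §1 is the two-line instantiation `Θ := theta13OfNumerics … (stage12NumericsOfThm1C …) …`, `hres := hasResidualsOfRecord_theta13OfNumerics …`
(12Q″ §1′ pattern) and is not restated.  ONE finite four-torus programme at fixed `ε = L^{-K}` — nothing continuum ∕ ℝ⁴ ∕ OS ∕ mass gap ∕ Clay.
-/

noncomputable section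

open MeasureTheory Set Finset Metric
open scoped Matrix.Norms.L2Operator BigOperators Matrix RealInnerProductSpace Real InnerProductSpace

namespace Summit.QuantumFields.YangMills.BalabanUVNodes.N12AtRecord13Prop1KnitAtZSeq

open Literature.MathematicalPhysics.QuantumFieldTheory.Balaban1983to89
open Literature.MathematicalPhysics.QuantumFieldTheory.Balaban1983to89.T4Continuum (T4Family)
open Literature.MathematicalPhysics.QuantumFieldTheory.Balaban1983to89.DagBinding
open Literature.MathematicalPhysics.QuantumFieldTheory.Balaban1983to89.Node00
open B15Claim189Assembly (new189 chiPP dom)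
open B15 (Prop1Printed Ineq180)
open B15.BasicStep (Claim189)
open B8Eq17ClassAkV1 (plaqsOf)
open B15RPrime1100OfRep (rPrimeDataOfSel)
open Summit.QuantumFields.YangMills.BalabanUVNodes.N12AtRecord13OfResiduals (b15Leaf_WOfRecord₁₃_liveRepin₁₃_of_massLive_of_hasResiduals)
-- dag-n12-c's vocabulary (as opened in `B15Prop1IntrinsicAnalyticAtRecord`)
open B15DeterminingSets (pts DetBackground)
open B15Prop1Carrier (lfVarOn InstOn InstOn.std plaqsInside)
open B15Prop1AtZSequenceRecord (exists_domain_prop1Printed_lfVarOn_std_su2_box_intrinsic_analytic_ofRecordFamily_ofNearValue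
  exists_domain_prop1Printed_lfVarOn_std_su2_box_intrinsic_analytic_atZSeqCoPRecord_ofNearValue exists_domain_prop1Printed_lfVarOn_std_su2_box_intrinsic_analytic_atZSeqCoPRecordTop_ofNearValue)
open B15Prop1GradientFromNearValueAtCoPRecord (far_letter_of_box)
open B16Sect1Wilson (wilsonLoc)
open B15Sect1Instances (bgKZstd)
open B15Prop1AnalyticExtClause (cplxVec anExt)
open B15Prop1ChartCalculusSU2 (E3)
open T4CubeChartGnomonic (SU2)
open B15Prop1ChartSU2 (su2Chart)
open B15Prop1SliceCoordinates (GaugeSlice ιA)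
open B15Prop1SliceTaylorCalculus (rGrad sliceFn)
open T4AxialGaugeSmallField (castSite boxPlaqs)
open B6BondElimination (unitVec)
open B16Eq18Proof (box)
open B15Extension193 (extend)
open B15ShellGauge193 (shellGauge)
open B5Bounds167Lattice (formDk ofRealCfg)
open B15Sect1Instances (fun177std)
open B14.Eq213DetSet (Bj maxDomT)
open B16Sect1Backgrounds (expMul)
open GaugeField (gaugeAct)

variable {N : ℕ} [NeZero N] {F : T4Family}

/-! ## §1. Generic `Θ` carrying node00-def-K0b's residuals (any `N`), background `bgOfRecord (av P i) (reg P i)` of a gauge-invariant class — at the live re-pin and at `θ₁₅ᶜ` -/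

section Live
variable (Θ : Stage13Params F N) (lam : ResidW F N)

/-- **★★ N12's ROW FOR THE RUNS BELOW THE TORUS AT THE ₁₃ LIVE RE-PIN, WITH THE PROPOSITION-1 DISPLAY DISCHARGED AT PRINT's SU(2) BOX INSTANCE OF (1.77), ONE (2.12) SOLUTION MAP PER INSTANCE** —
12E's `b15Leaf_WOfRecord₁₃_liveRepin₁₃_of_massLive_of_hasResiduals` at the LF-PINNED layer
`{λ with LF := fun P => lfVarOn su2Chart fun i => InstOn.std (bgOfRecord (av P i) (reg P i)) (M₁ P i) (Z P i) (Λ P i) (k P i) (M P i) (areg P i) (anExt …)}` on the run's lattice `F.P P.K`, its `hP1` slot fed, run by run,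
by dag-n12-c's `B15Prop1AtZSequenceRecord.exists_domain_prop1Printed_lfVarOn_std_su2_box_intrinsic_analytic_ofRecordFamily_ofNearValue` (`hcl := Subsingleton.elim _ _`; `hfar` from `hZ1` by `far_letter_of_box`); the thresholds `areg P i > 0` (print's `a₁`, p. 194) are the ones Proposition 1's proof produces.
Displayed: K0b's residuals `hres`; per run below the torus the (1.100) pin equation, live-mass, (1.80), (1.89) (letters `λ.D189 ∕ λ.D1100` untouched by the pin); per run and instance
dag-n12-c's structural box data, `hk0` ∕ `hk`, the class invariance `hreg P i`, and the letters (J1) `hGj`, (L2) `hlead` + `hsm` ∕ `hγle`, (Vn) `hVn` + `hcJ'`, the box inclusion `hZ1`.  Count-neutral; NOT a discharge of N12.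
[cite: Balaban1989LargeFieldI, (0.2)–(0.6) p.176, p.177 (i)–(ii), Prop. 1 (1.77)–(1.78) p.194 (incl. the last clause and the invariance sentence), p.193, (1.80) p.195, (1.89) p.198, (1.99)–(1.102) pp.200–201; Balaban1989LargeFieldII, (1.7)–(1.9) p.358, (1.11)–(1.13) p.359; Balaban1988Convergent, (2.12)–(2.13) pp.256–257, (3.16) p.268, (3.22)–(3.25) pp.269–270 (bookkeeping)] -/
theorem exists_pinLF_b15Leaf_WOfRecord₁₃_liveRepin₁₃_of_massLive_of_hasResiduals_of_nearValueLettersOfRecordFamily (hres : Θ.HasResidualsOfRecord F N)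
    -- N12's displays at the letters `kSel ∕ D189 ∕ D1100` of `λ`, run by run, BELOW THE TORUS
    (hpin : ∀ P : B12.RunParams, lam.kSel P < P.K → lam.D1100 P
      = rPrimeDataOfSel (reprTOfRecord₁₃ F N (Θ.liveRepin₁₃ F N) P (lam.kSel P))
          ((Θ.liveRepin₁₃ F N).ppSel P (gOfRecord₁₃ F N (Θ.liveRepin₁₃ F N) P) (lam.kSel P + 1))
          (fibOfSeq F (Θ.liveRepin₁₃ F N).ν (Θ.liveRepin₁₃ F N).τ9 P (gOfRecord₁₃ F N (Θ.liveRepin₁₃ F N) P) (lam.kSel P + 1)))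
    (hmassLive : ∀ P : B12.RunParams, lam.kSel P < P.K → ∀ s, LiveSeq F N Θ.ν Θ.τ9 P (gOfRecord₁₃ F N (Θ.liveRepin₁₃ F N) P) (lam.kSel P + 1)
        (slotsTOfRecord F N Θ.ν Θ.τ9 (EOfRecord₁₃ F N (Θ.liveRepin₁₃ F N)) (wOfRecord₉ F N (Θ.liveRepin₁₃ F N).toStage9Params)
          (Θ.liveRepin₁₃ F N).ppSel P (gOfRecord₁₃ F N (Θ.liveRepin₁₃ F N) P) (lam.kSel P + 1)) s →
      0 < ∫ V, rterm (reprTOfRecord₁₃ F N (Θ.liveRepin₁₃ F N) P (lam.kSel P)) s V ∂(fieldMeasure (F.P P.K) (lam.kSel P + 1) (SU N)))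
    (h180 : ∀ P : B12.RunParams, lam.kSel P < P.K → ∀ U, new189 (lam.D189 P) U → ∀ i, (lam.D189 P).h ≤ i → i ≤ (lam.D189 P).k →
      ∀ q ∈ plaqsOf (dom (lam.D189 P) i),
        Ineq180 ((lam.D189 P).dev0 U q) ((lam.D189 P).ε (lam.D189 P).k) (lam.D189 P).η (lam.D189 P).B₃ (lam.D189 P).B₅ (lam.D189 P).M (lam.D189 P).δ
          ((lam.D189 P).dist q) (lam.D189 P).O1)
    (h189 : ∀ P : B12.RunParams, lam.kSel P < P.K → Claim189 (new189 (lam.D189 P)) (chiPP (lam.D189 P)))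
    -- dag-n12-c's Proposition-1 instance data ON THE RUN's LATTICE `F.P P.K`, per run `P` and instance `i : ι P` (structural ∕ constants, exactly as in its endpoint of record)
    (hd3 : ∀ P : B12.RunParams, 3 ≤ (F.P P.K).d) (h0 : ∀ P : B12.RunParams, 0 < (F.P P.K).d) (ι : B12.RunParams → Type)
    (av : ∀ P : B12.RunParams, ι P → ∀ j : ℕ, Averaging (F.P P.K) j SU2)
    -- NODE 00's (2.12) solution map of record `bgOfRecord (av P i) (reg P i)` in a GAUGE-INVARIANT class `reg P` (dag-n12-c FILE 1∕4: the (181) letter is GONE)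
    (reg : ∀ P : B12.RunParams, ι P → Set (GaugeField (F.P P.K) 0 SU2))
    (hreg : ∀ (P : B12.RunParams) (i : ι P) (w : GaugeTransf (F.P P.K) 0 SU2) (U : GaugeField (F.P P.K) 0 SU2), U ∈ reg P i → gaugeAct w U ∈ reg P i)
    (M₁ : ∀ P : B12.RunParams, ι P → ℕ) (Z Λ : ∀ P : B12.RunParams, ι P → Set (Site (F.P P.K) 0))
    (k : ∀ P : B12.RunParams, ι P → ℕ) (M : ∀ P : B12.RunParams, ι P → ℝ) (hk0 : ∀ P i, 0 < k P i) (hk : ∀ P i, k P i ≤ (F.P P.K).m + (F.P P.K).K)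
    (eR : ∀ P : B12.RunParams, ι P → ℝ) (heR : ∀ P i, 0 < eR P i)
    (T : ∀ (P : B12.RunParams) (i : ι P), Finset (PBond (F.P P.K) (k P i)))
    (lo hi : ∀ P : B12.RunParams, ι P → Fin (F.P P.K).d → ℤ) (n : ∀ P : B12.RunParams, ι P → ℕ) (hn : ∀ P i κ, hi P i κ ≤ lo P i κ + n P i)
    (hN : ∀ P i, n P i + 2 < (F.P P.K).sitesPerDir (k P i))
    (hbox : ∀ P i, pts (k P i) (Λ P i) = (castSite '' Set.Icc (lo P i) (hi P i) : Set (Site (F.P P.K) (k P i))))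
    (hZ : ∀ P i, (boxPlaqs (lo P i - 1) (hi P i + 1) : Set (Plaq (F.P P.K) (k P i))) ⊆ plaqsInside (pts (k P i) (Z P i)))
    (hTG0 : ∀ P i, T P i = (box (fun κ => (hi P i κ - lo P i κ + 1).toNat) (lo P i)).image fun x =>
      (⟨castSite (x - unitVec ⟨0, h0 P⟩), ⟨0, h0 P⟩⟩ : PBond (F.P P.K) (k P i)))
    (hN5 : ∀ P i κ, ((hi P i κ - lo P i κ + 1).toNat : ℤ) + 5 < (F.P P.K).sitesPerDir (k P i))
    (Kb : ∀ P : B12.RunParams, ι P → ℕ) (hK1 : ∀ P i, 1 ≤ Kb P i) (hKn : ∀ P i κ, (hi P i κ - lo P i κ + 1).toNat ≤ Kb P i)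
    (ext : ∀ (P : B12.RunParams) (i : ι P), GaugeField (F.P P.K) (k P i) SU2 → GaugeField (F.P P.K) (k P i) SU2)
    (hext : ∀ P i Vk, ext P i Vk = extend (pts (k P i) (Λ P i)) (shellGauge Vk (lo P i) (hi P i)) Vk)
    (hlohi : ∀ P i, lo P i ≤ hi P i)
    {γ cJ bx : B12.RunParams → ℝ} (hγ : ∀ P, 0 < γ P) (hcJ : ∀ P, 0 ≤ cJ P) (hbx : ∀ P, 0 ≤ bx P)
    (hbxM : ∀ P i, 12 * ((F.P P.K).d : ℝ) * ((n P i : ℝ) + 2) ^ 2 ≤ bx P * (M P i) ^ 2)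
    {Cerr R 𝓐 : ∀ P : B12.RunParams, ι P → ℝ} (hM : ∀ P i, 1 ≤ M P i) (hR : ∀ P i, 0 < R P i) (h𝓐 : ∀ P i, 0 ≤ 𝓐 P i)
    (n' : ∀ P : B12.RunParams, ι P → ℕ) (hn' : ∀ P i, 1 ≤ n' P i)
    -- (J1) the JOINT holomorphic extension of print's function in the datum perturbation and the field
    (hGj : ∀ P i Vk, PlaqSmallOn (plaqsInside (pts (k P i) (Z P i ∩ (Λ P i)ᶜ))) (eR P i) Vk →
      ∃ 𝒢 : VecField (F.P P.K) (k P i) (EuclideanSpace ℂ (Fin 3)) × VecField (F.P P.K) (k P i) (EuclideanSpace ℂ (Fin 3)) → ℂ,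
        DifferentiableOn ℂ 𝒢 (ball 0 (R P i)) ∧
        (∀ z ∈ ball (0 : VecField (F.P P.K) (k P i) (EuclideanSpace ℂ (Fin 3)) × VecField (F.P P.K) (k P i) (EuclideanSpace ℂ (Fin 3))) (R P i), ‖𝒢 z‖ ≤ 𝓐 P i) ∧
        ∀ p B' : VecField (F.P P.K) (k P i) E3, ‖p‖ < R P i → ‖B'‖ < R P i →
          𝒢 (cplxVec p, cplxVec B') =
            ((fun177std (bgOfRecord (av P i) (reg P i)) (M₁ P i) (Z P i) (k P i) (expMul su2Chart B' (ext P i (expMul su2Chart p Vk))) : ℝ) : ℂ))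
    -- (L2) (1.7)–(1.9) p.358 for the Hessian of the slice function at `0`
    (hlead : ∀ P i Vk, PlaqSmallOn (plaqsInside (pts (k P i) (Z P i ∩ (Λ P i)ᶜ))) (eR P i) Vk →
      ∀ X : GaugeSlice (pts (k P i) (Λ P i)) (T P i) E3,
      |⟪X, (fderiv ℝ (rGrad (pts (k P i) (Λ P i)) (T P i)
              (sliceFn (pts (k P i) (Λ P i)) (T P i) (fun177std (bgOfRecord (av P i) (reg P i)) (M₁ P i) (Z P i) (k P i)) (ext P i Vk))) 0) X⟫ -
          ∑ a : Fin 3, formDk (n' P i) (fun _ : Fin (F.P P.K).d => (F.P P.K).sitesPerDir (k P i))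
            (ofRealCfg (fun _ : Fin (F.P P.K).d => (F.P P.K).sitesPerDir (k P i)) fun j =>
              ιA (pts (k P i) (Λ P i)) (T P i) X ⟨j.1, j.2⟩ a)| ≤ Cerr P i * ‖X‖ ^ 2)
    (hsm : ∀ P i, Cerr P i ≤ (4 / Real.pi ^ 2) ^ ((F.P P.K).d + 2) / (2 * (3 * (Kb P i : ℝ) ^ 2 + 2 * (Kb P i : ℝ) ^ 4)))
    (hγle : ∀ P i, γ P / (M P i) ^ 5 ≤ (4 / Real.pi ^ 2) ^ ((F.P P.K).d + 2) / (2 * (3 * (Kb P i : ℝ) ^ 2 + 2 * (Kb P i : ℝ) ^ 4)))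
    -- the geometric letter: every fine site whose k-block label lies in the box `[lo − 1, hi + 1]` lies in `Ω₁(Z)` (print: `Λ` deep inside `Z`); dag-n12-c's `far_letter_of_box` turns it into the bond letter `hfar`
    (hZ1 : ∀ P i (y : Site (F.P P.K) 0), B14.Eq22Determines.blockIter (k P i) y ∈ (castSite '' Set.Icc (lo P i - 1) (hi P i + 1) : Set (Site (F.P P.K) (k P i))) → y ∈ maxDomT (M₁ P i) (Z P i) 1)
    -- (Vn) the NEAR-FIELD part of (1.77) at the extended regular datum is small (replaces (L3); print p. 193 ll. 17–20 on `Z` — the regularity of [15] Thm 1's minimiser, N07's estimate)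
    {cA : B12.RunParams → ℝ}
    (hVn : ∀ P i ε Vk, 0 < ε → ε ≤ eR P i → PlaqSmallOn (plaqsInside (pts (k P i) (Z P i ∩ (Λ P i)ᶜ))) ε Vk →
      wilsonLoc ((plaqsOf (maxDomT (M₁ P i) (Z P i) 1)).indicator fun _ => (1 : ℝ)) (bgKZstd (bgOfRecord (av P i) (reg P i)) (M₁ P i) (Z P i) (k P i) (ext P i Vk)) ≤ cA P * ε ^ 2)
    (hcJ' : ∀ P i, 2 * cA P * eR P i / R P i + 4 * 𝓐 P i / (R P i * eR P i) ≤ cJ P) :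
    ∃ areg : ∀ P : B12.RunParams, ι P → ℝ, (∀ P i, 0 < areg P i) ∧
      ∀ P : B12.RunParams, lam.kSel P < P.K →
        B15Leaf (WOfRecord₁₃ F N (Θ.liveRepin₁₃ F N)
          { lam with LF := fun P => lfVarOn su2Chart fun i => InstOn.std (bgOfRecord (av P i) (reg P i)) (M₁ P i) (Z P i) (Λ P i) (k P i) (M P i) (areg P i)
                            (anExt (pts (k P i) (Λ P i)) (T P i) (fun177std (bgOfRecord (av P i) (reg P i)) (M₁ P i) (Z P i) (k P i)) (ext P i)
                              (min (1 / 2) (min (R P i / 8) (γ P / (M P i) ^ 5 * (R P i / 2) ^ 2 / (48 * (4 * 𝓐 P i / R P i + 1)))))) } P) := by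
  choose areg ha hP using fun P : B12.RunParams =>
    exists_domain_prop1Printed_lfVarOn_std_su2_box_intrinsic_analytic_ofRecordFamily_ofNearValue (hd3 := hd3 P) (h0 := h0 P) (hcl := Subsingleton.elim _ _) (av := av P) (reg := reg P) (hreg := hreg P)
      (M₁ := M₁ P) (Z := Z P) (Λ := Λ P) (k := k P) (M := M P) (hk0 := hk0 P) (hk := hk P) (eR := eR P) (heR := heR P) (T := T P) (lo := lo P) (hi := hi P) (n := n P) (hn := hn P)
      (hN := hN P) (hbox := hbox P) (hZ := hZ P) (hTG0 := hTG0 P) (hN5 := hN5 P) (K := Kb P) (hK1 := hK1 P) (hKn := hKn P) (ext := ext P) (hext := hext P) (hlohi := hlohi P)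
      (hγ := hγ P) (hcJ := hcJ P) (hbx := hbx P) (hbxM := hbxM P) (hM := hM P) (hR := hR P) (h𝓐 := h𝓐 P) (n' := n' P) (hn' := hn' P) (hGj := hGj P) (hlead := hlead P)
      (hsm := hsm P) (hγle := hγle P) (hfar := fun i b hb => far_letter_of_box (hbox P i) (hZ1 P i) b hb) (hVn := hVn P) (hcJ' := hcJ' P)
  refine ⟨areg, ha, fun P hkP => ?_⟩
  -- unify the LF-pinned layer from the goal first (the displays then match by projection reduction)
  apply b15Leaf_WOfRecord₁₃_liveRepin₁₃_of_massLive_of_hasResiduals Θ _ hres (P := P)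
  · exact hkP
  · exact hpin P hkP
  · exact hmassLive P hkP
  · exact hP P
  · exact h180 P hkP
  · exact h189 P hkP

end Live

/-! ## §2. `N = 2`, AT PRINT's (1.74) OBJECT: per instance the background is NODE 00's v1.5 constructor OF RECORD applied to `Z`'s OWN maximal sequence (2.13), `bgMSCoPOfRecord F 2 Θ.ν P.K (k P i) (maxDomT Θ.ν.M₁ (Z P i))` (NODE 00's support convention; dag-n12-c `…_atZSeqCoPRecord_ofNearValue`) -/

section RecordAtZSeq
variable (Θ : Stage13Params F 2) (lam : ResidW F 2)

/-- **★★★ AT `N = 2`, AT PRINT's (1.74) OBJECT `U_{k,Z} = U(𝔹_k(Z), ·)` — PER INSTANCE THE BACKGROUND IS NODE 00's v1.5 CONSTRUCTOR OF RECORD APPLIED TO `Z`'s OWN MAXIMAL SEQUENCE (2.13)**,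
`bgMSCoPOfRecord F 2 Θ.ν P.K (k P i) (maxDomT Θ.ν.M₁ (Z P i))` (NODE 00's SUPPORT CONVENTION: scale 0 on `hull(Ω₁(Z))`; the class AND the determining set `𝔹_k(Z)` of ONE sequence — dag-n12-c
LOCATED-CLASS l.20969: the run-level pin `bgMSCoPOfRecord F 2 Θ.ν P.K kb Ω_run` of 12Q′ §2 ∕ 12Q″ §2 paired the RUN's class with `Z`'s determining set, a (2.12) problem print never poses — SUPERSEDED
for consumption by this row), `M₁ := Θ.ν.M₁`, the class gauge-invariance DISCHARGED (`gaugeAct_mem_regMSCoPOfRecord`, inside dag-n12-c's `…_atZSeqCoPRecord_ofNearValue`, CONSUMED BY NAME run by run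
with `hcl := Subsingleton.elim _ _`).  NO BACKGROUND LETTER REMAINS: the background is an OBJECT of `(Θ.ν, P.K, k P i, Z P i)`.  Letters: regions, levels, `M`, box data; (J1) ∕ (L2) ∕ (Vn) ∕ `hZ1` and
`hk0` ∕ `hk`.  Print's term-by-term instances (one per large-field history `s` and box) are obtained by the closer's choice of `ι P`.  Count-neutral; NOT a discharge of N12.
[cite: Balaban1989LargeFieldI, (0.2)–(0.6) p.176, (1.74) p.192, p.193, Prop. 1 (1.77)–(1.78) p.194, (1.80) p.195, (1.89) p.198, (1.99)–(1.102) pp.200–201; Balaban1989LargeFieldII, (1.7)–(1.9) p.358, (1.11)–(1.13) p.359; Balaban1988Convergent, p.255, (2.12)–(2.13) pp.256–257, (3.16) p.268; Balaban1985Variational, (2),(5),(6) p.278 (bookkeeping)] -/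
theorem exists_pinLF_b15Leaf_WOfRecord₁₃_liveRepin₁₃_of_massLive_of_hasResiduals_of_nearValueLetters_atZSeqCoPRecord (hres : Θ.HasResidualsOfRecord F 2)
    -- N12's displays at the letters `kSel ∕ D189 ∕ D1100` of `λ`, run by run, BELOW THE TORUS
    (hpin : ∀ P : B12.RunParams, lam.kSel P < P.K → lam.D1100 P
      = rPrimeDataOfSel (reprTOfRecord₁₃ F 2 (Θ.liveRepin₁₃ F 2) P (lam.kSel P))
          ((Θ.liveRepin₁₃ F 2).ppSel P (gOfRecord₁₃ F 2 (Θ.liveRepin₁₃ F 2) P) (lam.kSel P + 1))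
          (fibOfSeq F (Θ.liveRepin₁₃ F 2).ν (Θ.liveRepin₁₃ F 2).τ9 P (gOfRecord₁₃ F 2 (Θ.liveRepin₁₃ F 2) P) (lam.kSel P + 1)))
    (hmassLive : ∀ P : B12.RunParams, lam.kSel P < P.K → ∀ s, LiveSeq F 2 Θ.ν Θ.τ9 P (gOfRecord₁₃ F 2 (Θ.liveRepin₁₃ F 2) P) (lam.kSel P + 1)
        (slotsTOfRecord F 2 Θ.ν Θ.τ9 (EOfRecord₁₃ F 2 (Θ.liveRepin₁₃ F 2)) (wOfRecord₉ F 2 (Θ.liveRepin₁₃ F 2).toStage9Params)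
          (Θ.liveRepin₁₃ F 2).ppSel P (gOfRecord₁₃ F 2 (Θ.liveRepin₁₃ F 2) P) (lam.kSel P + 1)) s →
      0 < ∫ V, rterm (reprTOfRecord₁₃ F 2 (Θ.liveRepin₁₃ F 2) P (lam.kSel P)) s V ∂(fieldMeasure (F.P P.K) (lam.kSel P + 1) (SU 2)))
    (h180 : ∀ P : B12.RunParams, lam.kSel P < P.K → ∀ U, new189 (lam.D189 P) U → ∀ i, (lam.D189 P).h ≤ i → i ≤ (lam.D189 P).k →
      ∀ q ∈ plaqsOf (dom (lam.D189 P) i),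
        Ineq180 ((lam.D189 P).dev0 U q) ((lam.D189 P).ε (lam.D189 P).k) (lam.D189 P).η (lam.D189 P).B₃ (lam.D189 P).B₅ (lam.D189 P).M (lam.D189 P).δ
          ((lam.D189 P).dist q) (lam.D189 P).O1)
    (h189 : ∀ P : B12.RunParams, lam.kSel P < P.K → Claim189 (new189 (lam.D189 P)) (chiPP (lam.D189 P)))
    -- dag-n12-c's Proposition-1 instance data ON THE RUN's LATTICE `F.P P.K`, per run `P` and instance `i : ι P` (structural ∕ constants, exactly as in its endpoint of record)
    (hd3 : ∀ P : B12.RunParams, 3 ≤ (F.P P.K).d) (h0 : ∀ P : B12.RunParams, 0 < (F.P P.K).d) (ι : B12.RunParams → Type)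
    -- NO background letters: per instance the class is that of `Z P i`'s OWN maximal sequence `maxDomT Θ.ν.M₁ (Z P i)` up to scale `k P i` (dag-n12-c LOCATED-CLASS)
    (Z Λ : ∀ P : B12.RunParams, ι P → Set (Site (F.P P.K) 0))
    (k : ∀ P : B12.RunParams, ι P → ℕ) (M : ∀ P : B12.RunParams, ι P → ℝ) (hk0 : ∀ P i, 0 < k P i) (hk : ∀ P i, k P i ≤ (F.P P.K).m + (F.P P.K).K)
    (eR : ∀ P : B12.RunParams, ι P → ℝ) (heR : ∀ P i, 0 < eR P i)
    (T : ∀ (P : B12.RunParams) (i : ι P), Finset (PBond (F.P P.K) (k P i)))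
    (lo hi : ∀ P : B12.RunParams, ι P → Fin (F.P P.K).d → ℤ) (n : ∀ P : B12.RunParams, ι P → ℕ) (hn : ∀ P i κ, hi P i κ ≤ lo P i κ + n P i)
    (hN : ∀ P i, n P i + 2 < (F.P P.K).sitesPerDir (k P i))
    (hbox : ∀ P i, pts (k P i) (Λ P i) = (castSite '' Set.Icc (lo P i) (hi P i) : Set (Site (F.P P.K) (k P i))))
    (hZ : ∀ P i, (boxPlaqs (lo P i - 1) (hi P i + 1) : Set (Plaq (F.P P.K) (k P i))) ⊆ plaqsInside (pts (k P i) (Z P i)))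
    (hTG0 : ∀ P i, T P i = (box (fun κ => (hi P i κ - lo P i κ + 1).toNat) (lo P i)).image fun x =>
      (⟨castSite (x - unitVec ⟨0, h0 P⟩), ⟨0, h0 P⟩⟩ : PBond (F.P P.K) (k P i)))
    (hN5 : ∀ P i κ, ((hi P i κ - lo P i κ + 1).toNat : ℤ) + 5 < (F.P P.K).sitesPerDir (k P i))
    (Kb : ∀ P : B12.RunParams, ι P → ℕ) (hK1 : ∀ P i, 1 ≤ Kb P i) (hKn : ∀ P i κ, (hi P i κ - lo P i κ + 1).toNat ≤ Kb P i)
    (ext : ∀ (P : B12.RunParams) (i : ι P), GaugeField (F.P P.K) (k P i) SU2 → GaugeField (F.P P.K) (k P i) SU2)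
    (hext : ∀ P i Vk, ext P i Vk = extend (pts (k P i) (Λ P i)) (shellGauge Vk (lo P i) (hi P i)) Vk)
    (hlohi : ∀ P i, lo P i ≤ hi P i)
    {γ cJ bx : B12.RunParams → ℝ} (hγ : ∀ P, 0 < γ P) (hcJ : ∀ P, 0 ≤ cJ P) (hbx : ∀ P, 0 ≤ bx P)
    (hbxM : ∀ P i, 12 * ((F.P P.K).d : ℝ) * ((n P i : ℝ) + 2) ^ 2 ≤ bx P * (M P i) ^ 2)
    {Cerr R 𝓐 : ∀ P : B12.RunParams, ι P → ℝ} (hM : ∀ P i, 1 ≤ M P i) (hR : ∀ P i, 0 < R P i) (h𝓐 : ∀ P i, 0 ≤ 𝓐 P i)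
    (n' : ∀ P : B12.RunParams, ι P → ℕ) (hn' : ∀ P i, 1 ≤ n' P i)
    -- (J1) the JOINT holomorphic extension of print's function in the datum perturbation and the field
    (hGj : ∀ P i Vk, PlaqSmallOn (plaqsInside (pts (k P i) (Z P i ∩ (Λ P i)ᶜ))) (eR P i) Vk →
      ∃ 𝒢 : VecField (F.P P.K) (k P i) (EuclideanSpace ℂ (Fin 3)) × VecField (F.P P.K) (k P i) (EuclideanSpace ℂ (Fin 3)) → ℂ,
        DifferentiableOn ℂ 𝒢 (ball 0 (R P i)) ∧
        (∀ z ∈ ball (0 : VecField (F.P P.K) (k P i) (EuclideanSpace ℂ (Fin 3)) × VecField (F.P P.K) (k P i) (EuclideanSpace ℂ (Fin 3))) (R P i), ‖𝒢 z‖ ≤ 𝓐 P i) ∧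
        ∀ p B' : VecField (F.P P.K) (k P i) E3, ‖p‖ < R P i → ‖B'‖ < R P i →
          𝒢 (cplxVec p, cplxVec B') =
            ((fun177std (bgMSCoPOfRecord F 2 Θ.ν P.K (k P i) (maxDomT Θ.ν.M₁ (Z P i))) Θ.ν.M₁ (Z P i) (k P i) (expMul su2Chart B' (ext P i (expMul su2Chart p Vk))) : ℝ) : ℂ))
    -- (L2) (1.7)–(1.9) p.358 for the Hessian of the slice function at `0`
    (hlead : ∀ P i Vk, PlaqSmallOn (plaqsInside (pts (k P i) (Z P i ∩ (Λ P i)ᶜ))) (eR P i) Vk →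
      ∀ X : GaugeSlice (pts (k P i) (Λ P i)) (T P i) E3,
      |⟪X, (fderiv ℝ (rGrad (pts (k P i) (Λ P i)) (T P i)
              (sliceFn (pts (k P i) (Λ P i)) (T P i) (fun177std (bgMSCoPOfRecord F 2 Θ.ν P.K (k P i) (maxDomT Θ.ν.M₁ (Z P i))) Θ.ν.M₁ (Z P i) (k P i)) (ext P i Vk))) 0) X⟫ -
          ∑ a : Fin 3, formDk (n' P i) (fun _ : Fin (F.P P.K).d => (F.P P.K).sitesPerDir (k P i))
            (ofRealCfg (fun _ : Fin (F.P P.K).d => (F.P P.K).sitesPerDir (k P i)) fun j =>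
              ιA (pts (k P i) (Λ P i)) (T P i) X ⟨j.1, j.2⟩ a)| ≤ Cerr P i * ‖X‖ ^ 2)
    (hsm : ∀ P i, Cerr P i ≤ (4 / Real.pi ^ 2) ^ ((F.P P.K).d + 2) / (2 * (3 * (Kb P i : ℝ) ^ 2 + 2 * (Kb P i : ℝ) ^ 4)))
    (hγle : ∀ P i, γ P / (M P i) ^ 5 ≤ (4 / Real.pi ^ 2) ^ ((F.P P.K).d + 2) / (2 * (3 * (Kb P i : ℝ) ^ 2 + 2 * (Kb P i : ℝ) ^ 4)))
    -- the geometric letter: every fine site whose k-block label lies in the box `[lo − 1, hi + 1]` lies in `Ω₁(Z)` (print: `Λ` deep inside `Z`); dag-n12-c's `far_letter_of_box` turns it into the bond letter `hfar`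
    (hZ1 : ∀ P i (y : Site (F.P P.K) 0), B14.Eq22Determines.blockIter (k P i) y ∈ (castSite '' Set.Icc (lo P i - 1) (hi P i + 1) : Set (Site (F.P P.K) (k P i))) → y ∈ maxDomT Θ.ν.M₁ (Z P i) 1)
    -- (Vn) the NEAR-FIELD part of (1.77) at the extended regular datum is small (replaces (L3); print p. 193 ll. 17–20 on `Z` — the regularity of [15] Thm 1's minimiser, N07's estimate)
    {cA : B12.RunParams → ℝ}
    (hVn : ∀ P i ε Vk, 0 < ε → ε ≤ eR P i → PlaqSmallOn (plaqsInside (pts (k P i) (Z P i ∩ (Λ P i)ᶜ))) ε Vk →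
      wilsonLoc ((plaqsOf (maxDomT Θ.ν.M₁ (Z P i) 1)).indicator fun _ => (1 : ℝ)) (bgKZstd (bgMSCoPOfRecord F 2 Θ.ν P.K (k P i) (maxDomT Θ.ν.M₁ (Z P i))) Θ.ν.M₁ (Z P i) (k P i) (ext P i Vk)) ≤ cA P * ε ^ 2)
    (hcJ' : ∀ P i, 2 * cA P * eR P i / R P i + 4 * 𝓐 P i / (R P i * eR P i) ≤ cJ P) :
    ∃ areg : ∀ P : B12.RunParams, ι P → ℝ, (∀ P i, 0 < areg P i) ∧
      ∀ P : B12.RunParams, lam.kSel P < P.K →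
        B15Leaf (WOfRecord₁₃ F 2 (Θ.liveRepin₁₃ F 2)
          { lam with LF := fun P => lfVarOn su2Chart fun i => InstOn.std (bgMSCoPOfRecord F 2 Θ.ν P.K (k P i) (maxDomT Θ.ν.M₁ (Z P i))) Θ.ν.M₁ (Z P i) (Λ P i) (k P i) (M P i) (areg P i)
                            (anExt (pts (k P i) (Λ P i)) (T P i) (fun177std (bgMSCoPOfRecord F 2 Θ.ν P.K (k P i) (maxDomT Θ.ν.M₁ (Z P i))) Θ.ν.M₁ (Z P i) (k P i)) (ext P i)
                              (min (1 / 2) (min (R P i / 8) (γ P / (M P i) ^ 5 * (R P i / 2) ^ 2 / (48 * (4 * 𝓐 P i / R P i + 1)))))) } P) := by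
  choose areg ha hP using fun P : B12.RunParams =>
    exists_domain_prop1Printed_lfVarOn_std_su2_box_intrinsic_analytic_atZSeqCoPRecord_ofNearValue (F := F) Θ.ν P.K (hd3 P) (h0 P) (hcl := Subsingleton.elim _ _)
      (Z := Z P) (Λ := Λ P) (k := k P) (M := M P) (hk0 := hk0 P) (hk := hk P) (eR := eR P) (heR := heR P) (T := T P) (lo := lo P) (hi := hi P) (n := n P) (hn := hn P)
      (hN := hN P) (hbox := hbox P) (hZ := hZ P) (hTG0 := hTG0 P) (hN5 := hN5 P) (K := Kb P) (hK1 := hK1 P) (hKn := hKn P) (ext := ext P) (hext := hext P) (hlohi := hlohi P)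
      (hγ := hγ P) (hcJ := hcJ P) (hbx := hbx P) (hbxM := hbxM P) (hM := hM P) (hR := hR P) (h𝓐 := h𝓐 P) (n' := n' P) (hn' := hn' P) (hGj := hGj P) (hlead := hlead P)
      (hsm := hsm P) (hγle := hγle P) (hfar := fun i b hb => far_letter_of_box (hbox P i) (hZ1 P i) b hb) (hVn := hVn P) (hcJ' := hcJ' P)
  refine ⟨areg, ha, fun P hkP => ?_⟩
  apply b15Leaf_WOfRecord₁₃_liveRepin₁₃_of_massLive_of_hasResiduals Θ _ hres (P := P)
  · exact hkP
  · exact hpin P hkP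
  · exact hmassLive P hkP
  · exact hP P
  · exact h180 P hkP
  · exact h189 P hkP

end RecordAtZSeq


/-! ## §3. `N = 2`, the same with print's full top domain `Ω₀ = Z` as support: `bgMSCoPOfRecordAt F 2 Θ.ν P.K (k P i) (Z P i) (maxDomT Θ.ν.M₁ (Z P i))` ([15] (2) at `j = 0` on `Z` verbatim; dag-n12-c `…_atZSeqCoPRecordTop_ofNearValue`) -/

section RecordAtZSeqTop
variable (Θ : Stage13Params F 2) (lam : ResidW F 2)

/-- **★★★ AT `N = 2`, THE SAME WITH PRINT's FULL TOP DOMAIN `Ω₀ = Z` AS SUPPORT** — per instance the background is `bgMSCoPOfRecordAt F 2 Θ.ν P.K (k P i) (Z P i) (maxDomT Θ.ν.M₁ (Z P i))`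
([15] (2) at `j = 0` on `Z` verbatim, `B14.Eq213DetSet.maxDomT_zero`; §2's twin with the support enlarged from `hull(Ω₁(Z))` to `Z` — only the scale-0 class clause on the pinned collar
`Z ∖ hull(Ω₁(Z))` differs, a feasibility condition on the datum), `M₁ := Θ.ν.M₁`, the class gauge-invariance DISCHARGED (`gaugeAct_mem_regMSCoPOfRecordAt`, inside dag-n12-c's
`…_atZSeqCoPRecordTop_ofNearValue`, CONSUMED BY NAME run by run with `hcl := Subsingleton.elim _ _`).  NO BACKGROUND LETTER REMAINS.  Count-neutral; NOT a discharge of N12.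
[cite: Balaban1989LargeFieldI, (0.2)–(0.6) p.176, (1.74) p.192, p.193, Prop. 1 (1.77)–(1.78) p.194, (1.80) p.195, (1.89) p.198, (1.99)–(1.102) pp.200–201; Balaban1989LargeFieldII, (1.7)–(1.9) p.358, (1.11)–(1.13) p.359; Balaban1988Convergent, (2.12)–(2.13) pp.256–257, (3.16) p.268; Balaban1985Variational, (2),(5),(6) p.278 (bookkeeping)] -/
theorem exists_pinLF_b15Leaf_WOfRecord₁₃_liveRepin₁₃_of_massLive_of_hasResiduals_of_nearValueLetters_atZSeqCoPRecordTop (hres : Θ.HasResidualsOfRecord F 2)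
    -- N12's displays at the letters `kSel ∕ D189 ∕ D1100` of `λ`, run by run, BELOW THE TORUS
    (hpin : ∀ P : B12.RunParams, lam.kSel P < P.K → lam.D1100 P
      = rPrimeDataOfSel (reprTOfRecord₁₃ F 2 (Θ.liveRepin₁₃ F 2) P (lam.kSel P))
          ((Θ.liveRepin₁₃ F 2).ppSel P (gOfRecord₁₃ F 2 (Θ.liveRepin₁₃ F 2) P) (lam.kSel P + 1))
          (fibOfSeq F (Θ.liveRepin₁₃ F 2).ν (Θ.liveRepin₁₃ F 2).τ9 P (gOfRecord₁₃ F 2 (Θ.liveRepin₁₃ F 2) P) (lam.kSel P + 1)))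
    (hmassLive : ∀ P : B12.RunParams, lam.kSel P < P.K → ∀ s, LiveSeq F 2 Θ.ν Θ.τ9 P (gOfRecord₁₃ F 2 (Θ.liveRepin₁₃ F 2) P) (lam.kSel P + 1)
        (slotsTOfRecord F 2 Θ.ν Θ.τ9 (EOfRecord₁₃ F 2 (Θ.liveRepin₁₃ F 2)) (wOfRecord₉ F 2 (Θ.liveRepin₁₃ F 2).toStage9Params)
          (Θ.liveRepin₁₃ F 2).ppSel P (gOfRecord₁₃ F 2 (Θ.liveRepin₁₃ F 2) P) (lam.kSel P + 1)) s →
      0 < ∫ V, rterm (reprTOfRecord₁₃ F 2 (Θ.liveRepin₁₃ F 2) P (lam.kSel P)) s V ∂(fieldMeasure (F.P P.K) (lam.kSel P + 1) (SU 2)))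
    (h180 : ∀ P : B12.RunParams, lam.kSel P < P.K → ∀ U, new189 (lam.D189 P) U → ∀ i, (lam.D189 P).h ≤ i → i ≤ (lam.D189 P).k →
      ∀ q ∈ plaqsOf (dom (lam.D189 P) i),
        Ineq180 ((lam.D189 P).dev0 U q) ((lam.D189 P).ε (lam.D189 P).k) (lam.D189 P).η (lam.D189 P).B₃ (lam.D189 P).B₅ (lam.D189 P).M (lam.D189 P).δ
          ((lam.D189 P).dist q) (lam.D189 P).O1)
    (h189 : ∀ P : B12.RunParams, lam.kSel P < P.K → Claim189 (new189 (lam.D189 P)) (chiPP (lam.D189 P)))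
    -- dag-n12-c's Proposition-1 instance data ON THE RUN's LATTICE `F.P P.K`, per run `P` and instance `i : ι P` (structural ∕ constants, exactly as in its endpoint of record)
    (hd3 : ∀ P : B12.RunParams, 3 ≤ (F.P P.K).d) (h0 : ∀ P : B12.RunParams, 0 < (F.P P.K).d) (ι : B12.RunParams → Type)
    -- NO background letters: per instance the class is that of `Z P i`'s OWN maximal sequence `maxDomT Θ.ν.M₁ (Z P i)` up to scale `k P i` (dag-n12-c LOCATED-CLASS)
    (Z Λ : ∀ P : B12.RunParams, ι P → Set (Site (F.P P.K) 0))
    (k : ∀ P : B12.RunParams, ι P → ℕ) (M : ∀ P : B12.RunParams, ι P → ℝ) (hk0 : ∀ P i, 0 < k P i) (hk : ∀ P i, k P i ≤ (F.P P.K).m + (F.P P.K).K)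
    (eR : ∀ P : B12.RunParams, ι P → ℝ) (heR : ∀ P i, 0 < eR P i)
    (T : ∀ (P : B12.RunParams) (i : ι P), Finset (PBond (F.P P.K) (k P i)))
    (lo hi : ∀ P : B12.RunParams, ι P → Fin (F.P P.K).d → ℤ) (n : ∀ P : B12.RunParams, ι P → ℕ) (hn : ∀ P i κ, hi P i κ ≤ lo P i κ + n P i)
    (hN : ∀ P i, n P i + 2 < (F.P P.K).sitesPerDir (k P i))
    (hbox : ∀ P i, pts (k P i) (Λ P i) = (castSite '' Set.Icc (lo P i) (hi P i) : Set (Site (F.P P.K) (k P i))))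
    (hZ : ∀ P i, (boxPlaqs (lo P i - 1) (hi P i + 1) : Set (Plaq (F.P P.K) (k P i))) ⊆ plaqsInside (pts (k P i) (Z P i)))
    (hTG0 : ∀ P i, T P i = (box (fun κ => (hi P i κ - lo P i κ + 1).toNat) (lo P i)).image fun x =>
      (⟨castSite (x - unitVec ⟨0, h0 P⟩), ⟨0, h0 P⟩⟩ : PBond (F.P P.K) (k P i)))
    (hN5 : ∀ P i κ, ((hi P i κ - lo P i κ + 1).toNat : ℤ) + 5 < (F.P P.K).sitesPerDir (k P i))
    (Kb : ∀ P : B12.RunParams, ι P → ℕ) (hK1 : ∀ P i, 1 ≤ Kb P i) (hKn : ∀ P i κ, (hi P i κ - lo P i κ + 1).toNat ≤ Kb P i)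
    (ext : ∀ (P : B12.RunParams) (i : ι P), GaugeField (F.P P.K) (k P i) SU2 → GaugeField (F.P P.K) (k P i) SU2)
    (hext : ∀ P i Vk, ext P i Vk = extend (pts (k P i) (Λ P i)) (shellGauge Vk (lo P i) (hi P i)) Vk)
    (hlohi : ∀ P i, lo P i ≤ hi P i)
    {γ cJ bx : B12.RunParams → ℝ} (hγ : ∀ P, 0 < γ P) (hcJ : ∀ P, 0 ≤ cJ P) (hbx : ∀ P, 0 ≤ bx P)
    (hbxM : ∀ P i, 12 * ((F.P P.K).d : ℝ) * ((n P i : ℝ) + 2) ^ 2 ≤ bx P * (M P i) ^ 2)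
    {Cerr R 𝓐 : ∀ P : B12.RunParams, ι P → ℝ} (hM : ∀ P i, 1 ≤ M P i) (hR : ∀ P i, 0 < R P i) (h𝓐 : ∀ P i, 0 ≤ 𝓐 P i)
    (n' : ∀ P : B12.RunParams, ι P → ℕ) (hn' : ∀ P i, 1 ≤ n' P i)
    -- (J1) the JOINT holomorphic extension of print's function in the datum perturbation and the field
    (hGj : ∀ P i Vk, PlaqSmallOn (plaqsInside (pts (k P i) (Z P i ∩ (Λ P i)ᶜ))) (eR P i) Vk →
      ∃ 𝒢 : VecField (F.P P.K) (k P i) (EuclideanSpace ℂ (Fin 3)) × VecField (F.P P.K) (k P i) (EuclideanSpace ℂ (Fin 3)) → ℂ,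
        DifferentiableOn ℂ 𝒢 (ball 0 (R P i)) ∧
        (∀ z ∈ ball (0 : VecField (F.P P.K) (k P i) (EuclideanSpace ℂ (Fin 3)) × VecField (F.P P.K) (k P i) (EuclideanSpace ℂ (Fin 3))) (R P i), ‖𝒢 z‖ ≤ 𝓐 P i) ∧
        ∀ p B' : VecField (F.P P.K) (k P i) E3, ‖p‖ < R P i → ‖B'‖ < R P i →
          𝒢 (cplxVec p, cplxVec B') =
            ((fun177std (bgMSCoPOfRecordAt F 2 Θ.ν P.K (k P i) (Z P i) (maxDomT Θ.ν.M₁ (Z P i))) Θ.ν.M₁ (Z P i) (k P i) (expMul su2Chart B' (ext P i (expMul su2Chart p Vk))) : ℝ) : ℂ))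
    -- (L2) (1.7)–(1.9) p.358 for the Hessian of the slice function at `0`
    (hlead : ∀ P i Vk, PlaqSmallOn (plaqsInside (pts (k P i) (Z P i ∩ (Λ P i)ᶜ))) (eR P i) Vk →
      ∀ X : GaugeSlice (pts (k P i) (Λ P i)) (T P i) E3,
      |⟪X, (fderiv ℝ (rGrad (pts (k P i) (Λ P i)) (T P i)
              (sliceFn (pts (k P i) (Λ P i)) (T P i) (fun177std (bgMSCoPOfRecordAt F 2 Θ.ν P.K (k P i) (Z P i) (maxDomT Θ.ν.M₁ (Z P i))) Θ.ν.M₁ (Z P i) (k P i)) (ext P i Vk))) 0) X⟫ -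
          ∑ a : Fin 3, formDk (n' P i) (fun _ : Fin (F.P P.K).d => (F.P P.K).sitesPerDir (k P i))
            (ofRealCfg (fun _ : Fin (F.P P.K).d => (F.P P.K).sitesPerDir (k P i)) fun j =>
              ιA (pts (k P i) (Λ P i)) (T P i) X ⟨j.1, j.2⟩ a)| ≤ Cerr P i * ‖X‖ ^ 2)
    (hsm : ∀ P i, Cerr P i ≤ (4 / Real.pi ^ 2) ^ ((F.P P.K).d + 2) / (2 * (3 * (Kb P i : ℝ) ^ 2 + 2 * (Kb P i : ℝ) ^ 4)))
    (hγle : ∀ P i, γ P / (M P i) ^ 5 ≤ (4 / Real.pi ^ 2) ^ ((F.P P.K).d + 2) / (2 * (3 * (Kb P i : ℝ) ^ 2 + 2 * (Kb P i : ℝ) ^ 4)))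
    -- the geometric letter: every fine site whose k-block label lies in the box `[lo − 1, hi + 1]` lies in `Ω₁(Z)` (print: `Λ` deep inside `Z`); dag-n12-c's `far_letter_of_box` turns it into the bond letter `hfar`
    (hZ1 : ∀ P i (y : Site (F.P P.K) 0), B14.Eq22Determines.blockIter (k P i) y ∈ (castSite '' Set.Icc (lo P i - 1) (hi P i + 1) : Set (Site (F.P P.K) (k P i))) → y ∈ maxDomT Θ.ν.M₁ (Z P i) 1)
    -- (Vn) the NEAR-FIELD part of (1.77) at the extended regular datum is small (replaces (L3); print p. 193 ll. 17–20 on `Z` — the regularity of [15] Thm 1's minimiser, N07's estimate)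
    {cA : B12.RunParams → ℝ}
    (hVn : ∀ P i ε Vk, 0 < ε → ε ≤ eR P i → PlaqSmallOn (plaqsInside (pts (k P i) (Z P i ∩ (Λ P i)ᶜ))) ε Vk →
      wilsonLoc ((plaqsOf (maxDomT Θ.ν.M₁ (Z P i) 1)).indicator fun _ => (1 : ℝ)) (bgKZstd (bgMSCoPOfRecordAt F 2 Θ.ν P.K (k P i) (Z P i) (maxDomT Θ.ν.M₁ (Z P i))) Θ.ν.M₁ (Z P i) (k P i) (ext P i Vk)) ≤ cA P * ε ^ 2)
    (hcJ' : ∀ P i, 2 * cA P * eR P i / R P i + 4 * 𝓐 P i / (R P i * eR P i) ≤ cJ P) :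
    ∃ areg : ∀ P : B12.RunParams, ι P → ℝ, (∀ P i, 0 < areg P i) ∧
      ∀ P : B12.RunParams, lam.kSel P < P.K →
        B15Leaf (WOfRecord₁₃ F 2 (Θ.liveRepin₁₃ F 2)
          { lam with LF := fun P => lfVarOn su2Chart fun i => InstOn.std (bgMSCoPOfRecordAt F 2 Θ.ν P.K (k P i) (Z P i) (maxDomT Θ.ν.M₁ (Z P i))) Θ.ν.M₁ (Z P i) (Λ P i) (k P i) (M P i) (areg P i)
                            (anExt (pts (k P i) (Λ P i)) (T P i) (fun177std (bgMSCoPOfRecordAt F 2 Θ.ν P.K (k P i) (Z P i) (maxDomT Θ.ν.M₁ (Z P i))) Θ.ν.M₁ (Z P i) (k P i)) (ext P i)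
                              (min (1 / 2) (min (R P i / 8) (γ P / (M P i) ^ 5 * (R P i / 2) ^ 2 / (48 * (4 * 𝓐 P i / R P i + 1)))))) } P) := by
  choose areg ha hP using fun P : B12.RunParams =>
    exists_domain_prop1Printed_lfVarOn_std_su2_box_intrinsic_analytic_atZSeqCoPRecordTop_ofNearValue (F := F) Θ.ν P.K (hd3 P) (h0 P) (hcl := Subsingleton.elim _ _)
      (Z := Z P) (Λ := Λ P) (k := k P) (M := M P) (hk0 := hk0 P) (hk := hk P) (eR := eR P) (heR := heR P) (T := T P) (lo := lo P) (hi := hi P) (n := n P) (hn := hn P)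
      (hN := hN P) (hbox := hbox P) (hZ := hZ P) (hTG0 := hTG0 P) (hN5 := hN5 P) (K := Kb P) (hK1 := hK1 P) (hKn := hKn P) (ext := ext P) (hext := hext P) (hlohi := hlohi P)
      (hγ := hγ P) (hcJ := hcJ P) (hbx := hbx P) (hbxM := hbxM P) (hM := hM P) (hR := hR P) (h𝓐 := h𝓐 P) (n' := n' P) (hn' := hn' P) (hGj := hGj P) (hlead := hlead P)
      (hsm := hsm P) (hγle := hγle P) (hfar := fun i b hb => far_letter_of_box (hbox P i) (hZ1 P i) b hb) (hVn := hVn P) (hcJ' := hcJ' P)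
  refine ⟨areg, ha, fun P hkP => ?_⟩
  apply b15Leaf_WOfRecord₁₃_liveRepin₁₃_of_massLive_of_hasResiduals Θ _ hres (P := P)
  · exact hkP
  · exact hpin P hkP
  · exact hmassLive P hkP
  · exact hP P
  · exact h180 P hkP
  · exact h189 P hkP

end RecordAtZSeqTop


end Summit.QuantumFields.YangMills.BalabanUVNodes.N12AtRecord13Prop1KnitAtZSeq
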